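import Literature.Probability.RandomPlanarGeometry.HexSAWSurfaceWallRenewalSlackTwoClassification
import HarnessLib

/-!
# Slack four, two down steps: the `k + 3` irreducible blocks of length `6k + 4` with `k` visits and two down steps

For the self-avoiding walk on the honeycomb lattice (brick-wall frame) in the half-plane `Y ≤ 0`, an IRREDUCIBLE POSITIVE WALL
BRIDGE `ω ∈ ipwb n` with `v = visits n ω` surface visits satisfies the six-step law `6v ≤ n` (`HexSAWSurfaceWallRenewalSixStep`);
slack zero and slack two are classified in `HexSAWSurfaceWallRenewalSixStepRigid` and `HexSAWSurfaceWallRenewalSlackTwoClassification`.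
This module opens SLACK FOUR, `m = 6k + 4` (length kept symbolic, `hm : m = 6 * k + 4`, `k ≥ 2`), with its lowest vertical stratum:
the blocks with exactly TWO down steps (the down-step count of `HexSAWSurfaceWallRenewalSixStepRigid` allows `#down ≤ 4` here).

* §1–§3, three explicit families as coordinate tables over `Tab.walk` (`HexSAWSurfaceFourthOrderLower`): the O block `g2o k`
  (dive at column `1`: `R D R D R^{2k} U L^{2k−1} U R^{2k−1}`, end column `2k+2`), the `k − 1` T blocks `g2t k a`
  (`R^{2a+1} D L^{2a−1} D R^{2k+2} U L^{2k−2a−1} U R^{2k−2a−1}`, `1 ≤ a ≤ k−1`, end column `2k+4` — the slack-two family F2a with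
  its bottom run two steps longer) and the three H blocks `g2h k j` (`R^{2k−1} D L^{2k−3} D R^{2k−2+2j} U R^{5−2j} U R`, `j ≤ 2`,
  end column `2k+6` — the hook staircase with a stretched exit); each is an irreducible positive wall bridge of length `6k+4` with
  `k` visits and down steps at two named times (`g2o_mem_ipwb`, `visits_g2o`, `stepsD_g2o`, …, `stepsD_g2h`);
* §4, they are pairwise distinct: `twoDownBlocks k` has `k + 3` elements (`card_twoDownBlocks`) and lies in the stratum
  (`twoDownBlocks_subset`, `add_three_le_card_filter_visits_two_down`);
* §5–§6, conversely every block of the stratum is one of them (`mem_twoDownBlocks_of_card_stepsD_eq_two`), so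
  `(ipwb m).filter (visits = k ∧ #down = 2) = twoDownBlocks k` (`filter_visits_two_down_eq_twoDownBlocks`) and
  `#{ω ∈ ipwb (6k+4) : visits = k, #down = 2} = k + 3` (`card_filter_visits_two_down`: `5, 6, 7, 8, …`).

PROOF.  The general-length tools of `HexSAWSurfaceWallRenewalSlackTwoClassification` apply verbatim: with `#up = #down = 2`
(`card_stepsU_eq_card_stepsD`) the vertical profile is read off by `profile_of_card_stepsD_eq_two`; the order `D U D U` is
impossible at any length (`dudu_false_of_mem_ipwb`); for `D D U U` the four runs sit on rows `−1, −2, −1, 0`, the visit count gives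
`s = p + 4k + 3` for the last up time, and the gap and charge counts `2k + 2 ≤ X ≤ 2k + 6` of `HexSAWSurfaceWallRenewalSixStepRigid`
leave three end columns, `d = ω s 0 ∈ {p+2, p+4, p+6}` (`dduu4_runs`); the two runs on row `−1` are disjoint (`dduu_row_disjoint`)
and irreducibility shields the turning columns from below and above (`dduu_shield_low` / `_high`); this pins the signs and the
turning columns (`dduu4_signs`: a rightward first run survives only from the dive column `1` and gives the O block; otherwise the
first run is the hairpin return to column `2`, the bottom run passes column `p`, and the third run either returns leftward — the run
lengths then force `c = 2k+4`, `d = p+4`: a T block — or continues rightward — they force `p = 2k−1`, `d = 2k+5` with the bottom run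
ending at an even column strictly between: an H block), then every coordinate (`dduu4_table_o` / `_t` / `_h`, `dduu4_tables`, `dduu_slack_four`), and a walk of
`saws m` agreeing with a table walk at all times `≤ m` is that table walk (`eq_tab_walk_of_forall`).

STATUS: lane theorem of the a-idea-1 bridge/renewal lineage (cars 71 `…SixStep`, 73 `…SixStepRigid`, 74a `…SlackTwoFamilies`,
74b `…SecondGap` / `…SlackTwoClassification`); the first stratum of the slack-four census `N_{3k+2,k}` («car 77»).  OURS (new in
writing, modest): the three families, the classification of the two-down stratum and its count `k + 3`; checked against the lane's
complete enumeration of the irreducible positive wall bridges of length `6k + 4` with `k` visits for `2 ≤ k ≤ 15` (`11, 33, 95, 260,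
649, …` blocks, of which exactly `k + 3` have two down steps, all of profile `D D U U` and of the three shapes above).  The printed
sources carry the renewal / irreducible-bridge structure (Madras–Slade §1.2, Definition 1.2.4 (bridges, p. 11); §4.2, Definition 4.2.1
(irreducible bridges, p. 90) and the remark before (4.2.21), p. 94, that an irreducible bridge of span `L` has at least `3L` steps;
Kesten), the brickwork frame of the honeycomb lattice (Enting–Jensen §7.4.2, Fig. 7.10) and the surface-visit statistic (Beaton et
al. §3.1) — none states these families, the classification or the count.  No budget options: every declaration
elaborates within 100 000 heartbeats on the reference farm (the table verifications are one lemma per family).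
-/

namespace Literature.Probability.RandomPlanarGeometry.SAW.HexBW.Wall

open Finset Filter Function
open Literature.Probability.LatticeModels Literature.Probability.Percolation SimpleGraph

variable {n : ℕ} {ω : ℕ → Site 2}

/-! ### §0  Two private tools -/

/-- The Boolean adjacency test `Eight.adjE` read as a proposition. [cite: EntingJensen2009, §7.4.2, Fig. 7.10 (brickwork form of the honeycomb lattice)] -/
private theorem adjE_iff_td {a b c d : ℤ} : Eight.adjE a b c d = true ↔
    ((c = a + 1 ∨ a = c + 1) ∧ d = b) ∨ (c = a ∧ ((d = b + 1 ∧ (a + b) % 2 = 0) ∨ (b = d + 1 ∧ (c + d) % 2 = 0))) := by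
  simp [Eight.adjE]

/-- A site of `Site 2` is determined by its two coordinates. [folklore] -/
private theorem site_ext_td {p q : Site 2} (h0 : p 0 = q 0) (h1 : p 1 = q 1) : p = q := by
  ext i; fin_cases i; exacts [h0, h1]

/-! ### §1  Family O (one block): `R D R D R^{2k} U L^{2k−1} U R^{2k−1}`, the dive at column `1`, `X_n = 2k + 2` -/

/-- Column table of the O block (length `6k+4`): `(t,0)` for `t ≤ 1`; `(t−1,−1)` for `t = 2, 3`; bottom run `(t−2,−2)` out to
column `2k+2`; return run `(4k+7−t,−1)` back to column `3`; final wall run `(t−4k−2,0)` out to `2k+2`.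
[cite: EntingJensen2009, §7.4.2, Fig. 7.10 (brickwork form of the honeycomb lattice)] -/
def g2oX (k t : ℕ) : ℤ :=
  if t ≤ 1 then (t : ℤ)
  else if t ≤ 3 then (t : ℤ) - 1
  else if t ≤ 2 * k + 4 then (t : ℤ) - 2
  else if t ≤ 4 * k + 4 then 4 * (k : ℤ) + 7 - t
  else (t : ℤ) - 4 * k - 2

/-- Height table of the O block. [cite: EntingJensen2009, §7.4.2, Fig. 7.10] -/
def g2oY (k t : ℕ) : ℤ :=
  if t ≤ 1 then 0
  else if t ≤ 3 then -1
  else if t ≤ 2 * k + 4 then -2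
  else if t ≤ 4 * k + 4 then -1
  else 0

/-- **The O block** `(0,0)→(1,0)↓(1,−1)→(2,−1)↓(2,−2)→…→(2k+2,−2)↑(2k+2,−1)←…←(3,−1)↑(3,0)→…→(2k+2,0)` of length `6k+4`.
[cite: EntingJensen2009, §7.4.2, Fig. 7.10] -/
def g2o (k : ℕ) : ℕ → Site 2 := Tab.walk (6 * k + 4) (g2oX k) (g2oY k)

/-- The five affine pieces of the O tables, with their values. [cite: EntingJensen2009, §7.4.2, Fig. 7.10] -/
private theorem g2o_cases (k t : ℕ) :
    (t ≤ 1 ∧ g2oX k t = t ∧ g2oY k t = 0) ∨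
      (2 ≤ t ∧ t ≤ 3 ∧ g2oX k t = (t : ℤ) - 1 ∧ g2oY k t = -1) ∨
      (4 ≤ t ∧ t ≤ 2 * k + 4 ∧ g2oX k t = (t : ℤ) - 2 ∧ g2oY k t = -2) ∨
      (2 * k + 5 ≤ t ∧ t ≤ 4 * k + 4 ∧ g2oX k t = 4 * (k : ℤ) + 7 - t ∧ g2oY k t = -1) ∨
      (4 * k + 5 ≤ t ∧ g2oX k t = (t : ℤ) - 4 * k - 2 ∧ g2oY k t = 0) := by
  simp only [g2oX, g2oY]
  split_ifs <;> omega

/-- **Coordinate facts of the O block** (`k ≥ 1`): brick-wall steps, self-avoidance, lower half-plane, columns in `[0, 2k+2]`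
and `≥ 1` after time `0`, start and end on the wall, even length. [cite: EntingJensen2009, §7.4.2, Fig. 7.10]
[cite: MadrasSlade1993, §1.2, Definition 1.2.4 (bridges, p. 11)] -/
theorem g2o_facts {k : ℕ} (hk : 1 ≤ k) : Tab.Facts (6 * k + 4) (g2oX k) (g2oY k) := by
  refine ⟨fun t ht => ?_, fun t ht s hs hx hy => ?_, fun t ht => ?_, fun t ht => ?_, ?_, ?_, ?_, by omega, fun t ht h1 => ?_⟩
  · rw [adjE_iff_td]
    rcases g2o_cases k t with ⟨h, x, y⟩ | ⟨l, h, x, y⟩ | ⟨l, h, x, y⟩ | ⟨l, h, x, y⟩ | ⟨l, x, y⟩ <;>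
      rcases g2o_cases k (t + 1) with ⟨h', x', y'⟩ | ⟨l', h', x', y'⟩ | ⟨l', h', x', y'⟩ | ⟨l', h', x', y'⟩ | ⟨l', x', y'⟩ <;>
        omega
  · rcases g2o_cases k t with ⟨h, x, y⟩ | ⟨l, h, x, y⟩ | ⟨l, h, x, y⟩ | ⟨l, h, x, y⟩ | ⟨l, x, y⟩ <;>
      rcases g2o_cases k s with ⟨h', x', y'⟩ | ⟨l', h', x', y'⟩ | ⟨l', h', x', y'⟩ | ⟨l', h', x', y'⟩ | ⟨l', x', y'⟩ <;>
        omega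
  · rcases g2o_cases k t with ⟨h, x, y⟩ | ⟨l, h, x, y⟩ | ⟨l, h, x, y⟩ | ⟨l, h, x, y⟩ | ⟨l, x, y⟩ <;> omega
  · have h0 := g2o_cases k 0
    have hL := g2o_cases k (6 * k + 4)
    rcases g2o_cases k t with ⟨h, x, y⟩ | ⟨l, h, x, y⟩ | ⟨l, h, x, y⟩ | ⟨l, h, x, y⟩ | ⟨l, x, y⟩ <;> omega
  · have h0 := g2o_cases k 0; omega
  · have h0 := g2o_cases k 0; omega
  · have hL := g2o_cases k (6 * k + 4); omega
  · rcases g2o_cases k t with ⟨h, x, y⟩ | ⟨l, h, x, y⟩ | ⟨l, h, x, y⟩ | ⟨l, h, x, y⟩ | ⟨l, x, y⟩ <;> omega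

/-- The O block is a positive wall bridge of length `m = 6k + 4` (length symbolic). [cite: MadrasSlade1993, §1.2, Definition 1.2.4 (p. 11)]
[cite: EntingJensen2009, §7.4.2, Fig. 7.10] -/
theorem g2o_mem_pwb {k m : ℕ} (hk : 1 ≤ k) (hm : m = 6 * k + 4) : g2o k ∈ pwb m :=
  mem_pwb_of_facts rfl (g2o_facts hk) hm

/-- Coordinates of the O block up to its length. [cite: EntingJensen2009, §7.4.2, Fig. 7.10] -/
theorem g2o_apply {k t : ℕ} (ht : t ≤ 6 * k + 4) : g2o k t 0 = g2oX k t ∧ g2o k t 1 = g2oY k t :=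
  tab_walk_apply ht

/-- **The O block is irreducible**: its only interior visits lie on the final wall run (times `t ≥ 4k+6`, columns `≤ 2k+1`),
after the bottom run reached column `2k + 2` at time `2k + 4`. [cite: MadrasSlade1993, §4.2, Definition 4.2.1 (p. 90)]
[cite: Kesten1963SAW, §4] [cite: EntingJensen2009, §7.4.2, Fig. 7.10] -/
theorem g2o_mem_ipwb {k m : ℕ} (hk : 1 ≤ k) (hm : m = 6 * k + 4) : g2o k ∈ ipwb m := by
  refine mem_ipwb_of_facts_wit rfl (g2o_facts hk) hm (by omega) fun t ht1 ht2 hte hY => ?_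
  rcases g2o_cases k t with ⟨h, x, y⟩ | ⟨l, h, x, y⟩ | ⟨l, h, x, y⟩ | ⟨l, h, x, y⟩ | ⟨l, x, y⟩
  · omega
  · omega
  · omega
  · omega
  · refine Or.inr ⟨2 * k + 4, by omega, by omega, ?_⟩
    rcases g2o_cases k (2 * k + 4) with ⟨h', x', y'⟩ | ⟨l', h', x', y'⟩ | ⟨l', h', x', y'⟩ | ⟨l', h', x', y'⟩ | ⟨l', x', y'⟩ <;>
      omega

/-- **The O block has `k` visits**, all on the final wall run (times `4k+6, …, 6k+4`).
[cite: BeatonBousquetMelouDeGierDuminilCopinGuttmann2014, §3.1 (arXiv v5 p. 8)] [cite: EntingJensen2009, §7.4.2, Fig. 7.10] -/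
theorem visits_g2o {k m : ℕ} (hk : 1 ≤ k) (hm : m = 6 * k + 4) : visits m (g2o k) = k := by
  have hY : ∀ t, t ≤ 6 * k + 4 → g2o k t 1 = g2oY k t := fun t ht => (g2o_apply ht).2
  have h1 : visits (0 + 1) (g2o k) = visits 0 (g2o k) + ((0 + 1) / 2 - 0 / 2) :=
    visits_add_of_wall fun q _ hq => by
      rw [hY _ (by omega)]
      rcases g2o_cases k (0 + q) with ⟨h', x', y'⟩ | ⟨l', h', x', y'⟩ | ⟨l', h', x', y'⟩ | ⟨l', h', x', y'⟩ | ⟨l', x', y'⟩ <;> omega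
  have h2 : visits (1 + (4 * k + 3)) (g2o k) = visits 1 (g2o k) :=
    visits_add_eq_left fun q hq1 hq2 h => by
      obtain ⟨-, h0⟩ := h
      rw [hY _ (by omega)] at h0
      rcases g2o_cases k (1 + q) with ⟨h', x', y'⟩ | ⟨l', h', x', y'⟩ | ⟨l', h', x', y'⟩ | ⟨l', h', x', y'⟩ | ⟨l', x', y'⟩ <;> omega
  have h3 : visits (4 * k + 4 + 2 * k) (g2o k) = visits (4 * k + 4) (g2o k) + ((4 * k + 4 + 2 * k) / 2 - (4 * k + 4) / 2) :=
    visits_add_of_wall fun q _ hq => by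
      rw [hY _ (by omega)]
      rcases g2o_cases k (4 * k + 4 + q) with ⟨h', x', y'⟩ | ⟨l', h', x', y'⟩ | ⟨l', h', x', y'⟩ | ⟨l', h', x', y'⟩ | ⟨l', x', y'⟩ <;>
        omega
  rw [zero_add, visits_zero, zero_add] at h1
  rw [show 1 + (4 * k + 3) = 4 * k + 4 by omega, h1] at h2
  rw [show 4 * k + 4 + 2 * k = 6 * k + 4 by omega, h2] at h3
  subst hm
  rw [h3]
  omega

/-- **The O block has two down steps**, at the times `1` and `3`. [cite: EntingJensen2009, §7.4.2, Fig. 7.10] -/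
theorem stepsD_g2o {k m : ℕ} (hk : 1 ≤ k) (hm : m = 6 * k + 4) : stepsD m (g2o k) = {1, 3} := by
  subst hm
  ext t
  simp only [stepsD, mem_filter, mem_range, mem_insert, mem_singleton]
  constructor
  · rintro ⟨ht, hx, hy⟩
    rw [(g2o_apply (t := t + 1) (by omega)).1, (g2o_apply (t := t) (by omega)).1] at hx
    rw [(g2o_apply (t := t + 1) (by omega)).2, (g2o_apply (t := t) (by omega)).2] at hy
    rcases g2o_cases k t with ⟨h, x, y⟩ | ⟨l, h, x, y⟩ | ⟨l, h, x, y⟩ | ⟨l, h, x, y⟩ | ⟨l, x, y⟩ <;>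
      rcases g2o_cases k (t + 1) with ⟨h', x', y'⟩ | ⟨l', h', x', y'⟩ | ⟨l', h', x', y'⟩ | ⟨l', h', x', y'⟩ | ⟨l', x', y'⟩ <;>
        omega
  · intro ht
    have ht4 : t + 1 ≤ 6 * k + 4 := by omega
    refine ⟨by omega, ?_, ?_⟩
    · rw [(g2o_apply ht4).1, (g2o_apply (t := t) (by omega)).1]
      rcases g2o_cases k t with ⟨h, x, y⟩ | ⟨l, h, x, y⟩ | ⟨l, h, x, y⟩ | ⟨l, h, x, y⟩ | ⟨l, x, y⟩ <;>
        rcases g2o_cases k (t + 1) with ⟨h', x', y'⟩ | ⟨l', h', x', y'⟩ | ⟨l', h', x', y'⟩ | ⟨l', h', x', y'⟩ | ⟨l', x', y'⟩ <;>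
          omega
    · rw [(g2o_apply ht4).2, (g2o_apply (t := t) (by omega)).2]
      rcases g2o_cases k t with ⟨h, x, y⟩ | ⟨l, h, x, y⟩ | ⟨l, h, x, y⟩ | ⟨l, h, x, y⟩ | ⟨l, x, y⟩ <;>
        rcases g2o_cases k (t + 1) with ⟨h', x', y'⟩ | ⟨l', h', x', y'⟩ | ⟨l', h', x', y'⟩ | ⟨l', h', x', y'⟩ | ⟨l', x', y'⟩ <;>
          omega


/-! ### §2  Family T (`k − 1` blocks): `R^{2a+1} D L^{2a−1} D R^{2k+2} U L^{2k−2a−1} U R^{2k−2a−1}` (`1 ≤ a ≤ k − 1`), `X_n = 2k + 4` -/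

/-- Column table of the T block with hairpin parameter `a` (`1 ≤ a ≤ k−1`, length `6k+4`): wall run `(t,0)`, `t ≤ 2a+1`; return
run `(4a+3−t,−1)` back to column `2`; bottom run `(t−4a,−2)` out to column `2k+4`; return run `(4a+4k+9−t,−1)` back to column
`2a+5`; final wall run `(t−4k,0)` out to `2k+4` — the slack-two block F2a with its bottom run two steps longer.
[cite: EntingJensen2009, §7.4.2, Fig. 7.10 (brickwork form of the honeycomb lattice)] -/
def g2tX (k a t : ℕ) : ℤ :=
  if t ≤ 2 * a + 1 then (t : ℤ)
  else if t ≤ 4 * a + 1 then 4 * (a : ℤ) + 3 - t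
  else if t ≤ 4 * a + 2 * k + 4 then (t : ℤ) - 4 * a
  else if t ≤ 2 * a + 4 * k + 4 then 4 * (a : ℤ) + 4 * k + 9 - t
  else (t : ℤ) - 4 * k

/-- Height table of the T block. [cite: EntingJensen2009, §7.4.2, Fig. 7.10] -/
def g2tY (k a t : ℕ) : ℤ :=
  if t ≤ 2 * a + 1 then 0
  else if t ≤ 4 * a + 1 then -1
  else if t ≤ 4 * a + 2 * k + 4 then -2
  else if t ≤ 2 * a + 4 * k + 4 then -1
  else 0

/-- **The T block** `(0,0)→…→(2a+1,0)↓←…←(2,−1)↓(2,−2)→…→(2k+4,−2)↑(2k+4,−1)←…←(2a+5,−1)↑(2a+5,0)→…→(2k+4,0)` of length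
`6k+4` (`1 ≤ a ≤ k−1`). [cite: EntingJensen2009, §7.4.2, Fig. 7.10] -/
def g2t (k a : ℕ) : ℕ → Site 2 := Tab.walk (6 * k + 4) (g2tX k a) (g2tY k a)

/-- The five affine pieces of the T tables, with their values. [cite: EntingJensen2009, §7.4.2, Fig. 7.10] -/
private theorem g2t_cases (k a t : ℕ) :
    (t ≤ 2 * a + 1 ∧ g2tX k a t = t ∧ g2tY k a t = 0) ∨
      (2 * a + 2 ≤ t ∧ t ≤ 4 * a + 1 ∧ g2tX k a t = 4 * (a : ℤ) + 3 - t ∧ g2tY k a t = -1) ∨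
      (4 * a + 2 ≤ t ∧ t ≤ 4 * a + 2 * k + 4 ∧ g2tX k a t = (t : ℤ) - 4 * a ∧ g2tY k a t = -2) ∨
      (4 * a + 2 * k + 5 ≤ t ∧ t ≤ 2 * a + 4 * k + 4 ∧ g2tX k a t = 4 * (a : ℤ) + 4 * k + 9 - t ∧ g2tY k a t = -1) ∨
      (2 * a + 4 * k + 5 ≤ t ∧ g2tX k a t = (t : ℤ) - 4 * k ∧ g2tY k a t = 0) := by
  simp only [g2tX, g2tY]
  split_ifs <;> omega

/-- **Coordinate facts of the T block** (`1 ≤ a ≤ k − 1`). [cite: EntingJensen2009, §7.4.2, Fig. 7.10]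
[cite: MadrasSlade1993, §1.2, Definition 1.2.4 (bridges, p. 11)] -/
theorem g2t_facts {k a : ℕ} (ha : 1 ≤ a) (hak : a + 1 ≤ k) : Tab.Facts (6 * k + 4) (g2tX k a) (g2tY k a) := by
  refine ⟨fun t ht => ?_, fun t ht s hs hx hy => ?_, fun t ht => ?_, fun t ht => ?_, ?_, ?_, ?_, by omega, fun t ht h1 => ?_⟩
  · rw [adjE_iff_td]
    rcases g2t_cases k a t with ⟨h, x, y⟩ | ⟨l, h, x, y⟩ | ⟨l, h, x, y⟩ | ⟨l, h, x, y⟩ | ⟨l, x, y⟩ <;>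
      rcases g2t_cases k a (t + 1) with ⟨h', x', y'⟩ | ⟨l', h', x', y'⟩ | ⟨l', h', x', y'⟩ | ⟨l', h', x', y'⟩ | ⟨l', x', y'⟩ <;>
        omega
  · rcases g2t_cases k a t with ⟨h, x, y⟩ | ⟨l, h, x, y⟩ | ⟨l, h, x, y⟩ | ⟨l, h, x, y⟩ | ⟨l, x, y⟩ <;>
      rcases g2t_cases k a s with ⟨h', x', y'⟩ | ⟨l', h', x', y'⟩ | ⟨l', h', x', y'⟩ | ⟨l', h', x', y'⟩ | ⟨l', x', y'⟩ <;>
        omega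
  · rcases g2t_cases k a t with ⟨h, x, y⟩ | ⟨l, h, x, y⟩ | ⟨l, h, x, y⟩ | ⟨l, h, x, y⟩ | ⟨l, x, y⟩ <;> omega
  · have h0 := g2t_cases k a 0
    have hL := g2t_cases k a (6 * k + 4)
    rcases g2t_cases k a t with ⟨h, x, y⟩ | ⟨l, h, x, y⟩ | ⟨l, h, x, y⟩ | ⟨l, h, x, y⟩ | ⟨l, x, y⟩ <;> omega
  · have h0 := g2t_cases k a 0; omega
  · have h0 := g2t_cases k a 0; omega
  · have hL := g2t_cases k a (6 * k + 4); omega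
  · rcases g2t_cases k a t with ⟨h, x, y⟩ | ⟨l, h, x, y⟩ | ⟨l, h, x, y⟩ | ⟨l, h, x, y⟩ | ⟨l, x, y⟩ <;> omega

/-- The T block is a positive wall bridge of length `m = 6k + 4`. [cite: MadrasSlade1993, §1.2, Definition 1.2.4 (p. 11)]
[cite: EntingJensen2009, §7.4.2, Fig. 7.10] -/
theorem g2t_mem_pwb {k a m : ℕ} (ha : 1 ≤ a) (hak : a + 1 ≤ k) (hm : m = 6 * k + 4) : g2t k a ∈ pwb m :=
  mem_pwb_of_facts rfl (g2t_facts ha hak) hm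

/-- Coordinates of the T block up to its length. [cite: EntingJensen2009, §7.4.2, Fig. 7.10] -/
theorem g2t_apply {k a t : ℕ} (ht : t ≤ 6 * k + 4) : g2t k a t 0 = g2tX k a t ∧ g2t k a t 1 = g2tY k a t :=
  tab_walk_apply ht

/-- **The T block is irreducible**: the interior visits of the initial wall run (times `t ≤ 2a`) are followed by the return to
column `2 ≤ t` at time `4a + 1`, those of the final wall run (times `t ≥ 2a+4k+6`) are preceded by the bottom run's far end
`2k + 4 > X_t` at time `4a + 2k + 4`. [cite: MadrasSlade1993, §4.2, Definition 4.2.1 (p. 90)] [cite: Kesten1963SAW, §4]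
[cite: EntingJensen2009, §7.4.2, Fig. 7.10] -/
theorem g2t_mem_ipwb {k a m : ℕ} (ha : 1 ≤ a) (hak : a + 1 ≤ k) (hm : m = 6 * k + 4) : g2t k a ∈ ipwb m := by
  refine mem_ipwb_of_facts_wit rfl (g2t_facts ha hak) hm (by omega) fun t ht1 ht2 hte hY => ?_
  rcases g2t_cases k a t with ⟨h, x, y⟩ | ⟨l, h, x, y⟩ | ⟨l, h, x, y⟩ | ⟨l, h, x, y⟩ | ⟨l, x, y⟩
  · refine Or.inl ⟨4 * a + 1, by omega, by omega, ?_⟩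
    rcases g2t_cases k a (4 * a + 1) with ⟨h', x', y'⟩ | ⟨l', h', x', y'⟩ | ⟨l', h', x', y'⟩ | ⟨l', h', x', y'⟩ | ⟨l', x', y'⟩ <;> omega
  · omega
  · omega
  · omega
  · refine Or.inr ⟨4 * a + 2 * k + 4, by omega, by omega, ?_⟩
    rcases g2t_cases k a (4 * a + 2 * k + 4) with ⟨h', x', y'⟩ | ⟨l', h', x', y'⟩ | ⟨l', h', x', y'⟩ | ⟨l', h', x', y'⟩ | ⟨l', x', y'⟩ <;>
      omega

/-- **The T block has `k` visits** (`a` on the initial wall run, `k − a` on the final one).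
[cite: BeatonBousquetMelouDeGierDuminilCopinGuttmann2014, §3.1 (arXiv v5 p. 8)] [cite: EntingJensen2009, §7.4.2, Fig. 7.10] -/
theorem visits_g2t {k a m : ℕ} (ha : 1 ≤ a) (hak : a + 1 ≤ k) (hm : m = 6 * k + 4) : visits m (g2t k a) = k := by
  have hY : ∀ t, t ≤ 6 * k + 4 → g2t k a t 1 = g2tY k a t := fun t ht => (g2t_apply ht).2
  have h1 : visits (0 + (2 * a + 1)) (g2t k a) = visits 0 (g2t k a) + ((0 + (2 * a + 1)) / 2 - 0 / 2) :=
    visits_add_of_wall fun q _ hq => by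
      rw [hY _ (by omega)]
      rcases g2t_cases k a (0 + q) with ⟨h', x', y'⟩ | ⟨l', h', x', y'⟩ | ⟨l', h', x', y'⟩ | ⟨l', h', x', y'⟩ | ⟨l', x', y'⟩ <;> omega
  have h2 : visits (2 * a + 1 + (4 * k + 3)) (g2t k a) = visits (2 * a + 1) (g2t k a) :=
    visits_add_eq_left fun q hq1 hq2 h => by
      obtain ⟨-, h0⟩ := h
      rw [hY _ (by omega)] at h0
      rcases g2t_cases k a (2 * a + 1 + q) with ⟨h', x', y'⟩ | ⟨l', h', x', y'⟩ | ⟨l', h', x', y'⟩ | ⟨l', h', x', y'⟩ | ⟨l', x', y'⟩ <;> omega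
  have h3 : visits (2 * a + 4 * k + 4 + (2 * k - 2 * a)) (g2t k a) =
      visits (2 * a + 4 * k + 4) (g2t k a) + ((2 * a + 4 * k + 4 + (2 * k - 2 * a)) / 2 - (2 * a + 4 * k + 4) / 2) :=
    visits_add_of_wall fun q _ hq => by
      rw [hY _ (by omega)]
      rcases g2t_cases k a (2 * a + 4 * k + 4 + q) with ⟨h', x', y'⟩ | ⟨l', h', x', y'⟩ | ⟨l', h', x', y'⟩ | ⟨l', h', x', y'⟩ | ⟨l', x', y'⟩ <;>
        omega
  rw [zero_add, visits_zero, zero_add] at h1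
  rw [show 2 * a + 1 + (4 * k + 3) = 2 * a + 4 * k + 4 by omega, h1] at h2
  rw [show 2 * a + 4 * k + 4 + (2 * k - 2 * a) = 6 * k + 4 by omega, h2] at h3
  subst hm
  rw [h3]
  omega

/-- **The T block has two down steps**, at the times `2a + 1` and `4a + 1`. [cite: EntingJensen2009, §7.4.2, Fig. 7.10] -/
theorem stepsD_g2t {k a m : ℕ} (ha : 1 ≤ a) (hak : a + 1 ≤ k) (hm : m = 6 * k + 4) :
    stepsD m (g2t k a) = {2 * a + 1, 4 * a + 1} := by
  subst hm
  ext t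
  simp only [stepsD, mem_filter, mem_range, mem_insert, mem_singleton]
  constructor
  · rintro ⟨ht, hx, hy⟩
    rw [(g2t_apply (t := t + 1) (by omega)).1, (g2t_apply (t := t) (by omega)).1] at hx
    rw [(g2t_apply (t := t + 1) (by omega)).2, (g2t_apply (t := t) (by omega)).2] at hy
    rcases g2t_cases k a t with ⟨h, x, y⟩ | ⟨l, h, x, y⟩ | ⟨l, h, x, y⟩ | ⟨l, h, x, y⟩ | ⟨l, x, y⟩ <;>
      rcases g2t_cases k a (t + 1) with ⟨h', x', y'⟩ | ⟨l', h', x', y'⟩ | ⟨l', h', x', y'⟩ | ⟨l', h', x', y'⟩ | ⟨l', x', y'⟩ <;>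
        omega
  · intro ht
    have ht4 : t + 1 ≤ 6 * k + 4 := by omega
    refine ⟨by omega, ?_, ?_⟩
    · rw [(g2t_apply ht4).1, (g2t_apply (t := t) (by omega)).1]
      rcases g2t_cases k a t with ⟨h, x, y⟩ | ⟨l, h, x, y⟩ | ⟨l, h, x, y⟩ | ⟨l, h, x, y⟩ | ⟨l, x, y⟩ <;>
        rcases g2t_cases k a (t + 1) with ⟨h', x', y'⟩ | ⟨l', h', x', y'⟩ | ⟨l', h', x', y'⟩ | ⟨l', h', x', y'⟩ | ⟨l', x', y'⟩ <;>
          omega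
    · rw [(g2t_apply ht4).2, (g2t_apply (t := t) (by omega)).2]
      rcases g2t_cases k a t with ⟨h, x, y⟩ | ⟨l, h, x, y⟩ | ⟨l, h, x, y⟩ | ⟨l, h, x, y⟩ | ⟨l, x, y⟩ <;>
        rcases g2t_cases k a (t + 1) with ⟨h', x', y'⟩ | ⟨l', h', x', y'⟩ | ⟨l', h', x', y'⟩ | ⟨l', h', x', y'⟩ | ⟨l', x', y'⟩ <;>
          omega

/-! ### §3  Family H (three blocks): `R^{2k−1} D L^{2k−3} D R^{2k−2+2j} U R^{5−2j} U R` (`j ∈ {0,1,2}`), `X_n = 2k + 6` -/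

/-- Column table of the H block (`k ≥ 2`, `j ≤ 2`, length `6k+4`): wall run `(t,0)`, `t ≤ 2k−1`; return run `(4k−1−t,−1)` back to
column `2`; bottom run `(t+4−4k,−2)` out to column `2k+2j`; row-`−1` run `(t+3−4k,−1)` out to column `2k+5`; last step to `(2k+6, 0)`
— the hook staircase `H_k` with its exit stretched by four columns. [cite: EntingJensen2009, §7.4.2, Fig. 7.10 (brickwork form of the honeycomb lattice)] -/
def g2hX (k j t : ℕ) : ℤ :=
  if t + 1 ≤ 2 * k then (t : ℤ)
  else if t + 3 ≤ 4 * k then 4 * (k : ℤ) - 1 - t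
  else if t + 4 ≤ 6 * k + 2 * j then (t : ℤ) + 4 - 4 * k
  else if t ≤ 6 * k + 2 then (t : ℤ) + 3 - 4 * k
  else (t : ℤ) + 2 - 4 * k

/-- Height table of the H blocks. [cite: EntingJensen2009, §7.4.2, Fig. 7.10] -/
def g2hY (k j t : ℕ) : ℤ :=
  if t + 1 ≤ 2 * k then 0
  else if t + 3 ≤ 4 * k then -1
  else if t + 4 ≤ 6 * k + 2 * j then -2
  else if t ≤ 6 * k + 2 then -1
  else 0

/-- **The H block** `(0,0)→…→(2k−1,0)↓←…←(2,−1)↓(2,−2)→…→(2k+2j,−2)↑→…→(2k+5,−1)↑(2k+5,0)→(2k+6,0)` of length `6k+4`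
(`j ∈ {0,1,2}`). [cite: EntingJensen2009, §7.4.2, Fig. 7.10] -/
def g2h (k j : ℕ) : ℕ → Site 2 := Tab.walk (6 * k + 4) (g2hX k j) (g2hY k j)

/-- The five affine pieces of the H tables, with their values. [cite: EntingJensen2009, §7.4.2, Fig. 7.10] -/
private theorem g2h_cases (k j t : ℕ) :
    (t + 1 ≤ 2 * k ∧ g2hX k j t = (t : ℤ) ∧ g2hY k j t = 0) ∨
      (2 * k ≤ t ∧ t + 3 ≤ 4 * k ∧ g2hX k j t = 4 * (k : ℤ) - 1 - t ∧ g2hY k j t = -1) ∨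
      (4 * k ≤ t + 2 ∧ t + 4 ≤ 6 * k + 2 * j ∧ g2hX k j t = (t : ℤ) + 4 - 4 * k ∧ g2hY k j t = -2) ∨
      (6 * k + 2 * j ≤ t + 3 ∧ t ≤ 6 * k + 2 ∧ g2hX k j t = (t : ℤ) + 3 - 4 * k ∧ g2hY k j t = -1) ∨
      (6 * k + 3 ≤ t ∧ g2hX k j t = (t : ℤ) + 2 - 4 * k ∧ g2hY k j t = 0) := by
  simp only [g2hX, g2hY]
  split_ifs <;> omega

/-- **Coordinate facts of the H block** (`k ≥ 2`, `j ≤ 2`). [cite: EntingJensen2009, §7.4.2, Fig. 7.10]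
[cite: MadrasSlade1993, §1.2, Definition 1.2.4 (bridges, p. 11)] -/
theorem g2h_facts {k j : ℕ} (hk : 2 ≤ k) (hj : j ≤ 2) : Tab.Facts (6 * k + 4) (g2hX k j) (g2hY k j) := by
  refine ⟨fun t ht => ?_, fun t ht s hs hx hy => ?_, fun t ht => ?_, fun t ht => ?_, ?_, ?_, ?_, by omega, fun t ht h1 => ?_⟩
  · rw [adjE_iff_td]
    rcases g2h_cases k j t with ⟨h, x, y⟩ | ⟨l, h, x, y⟩ | ⟨l, h, x, y⟩ | ⟨l, h, x, y⟩ | ⟨l, x, y⟩ <;>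
      rcases g2h_cases k j (t + 1) with ⟨h', x', y'⟩ | ⟨l', h', x', y'⟩ | ⟨l', h', x', y'⟩ | ⟨l', h', x', y'⟩ | ⟨l', x', y'⟩ <;>
        omega
  · rcases g2h_cases k j t with ⟨h, x, y⟩ | ⟨l, h, x, y⟩ | ⟨l, h, x, y⟩ | ⟨l, h, x, y⟩ | ⟨l, x, y⟩ <;>
      rcases g2h_cases k j s with ⟨h', x', y'⟩ | ⟨l', h', x', y'⟩ | ⟨l', h', x', y'⟩ | ⟨l', h', x', y'⟩ | ⟨l', x', y'⟩ <;>
        omega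
  · rcases g2h_cases k j t with ⟨h, x, y⟩ | ⟨l, h, x, y⟩ | ⟨l, h, x, y⟩ | ⟨l, h, x, y⟩ | ⟨l, x, y⟩ <;> omega
  · have h0 := g2h_cases k j 0
    have hL := g2h_cases k j (6 * k + 4)
    rcases g2h_cases k j t with ⟨h, x, y⟩ | ⟨l, h, x, y⟩ | ⟨l, h, x, y⟩ | ⟨l, h, x, y⟩ | ⟨l, x, y⟩ <;> omega
  · have h0 := g2h_cases k j 0; omega
  · have h0 := g2h_cases k j 0; omega
  · have hL := g2h_cases k j (6 * k + 4); omega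
  · rcases g2h_cases k j t with ⟨h, x, y⟩ | ⟨l, h, x, y⟩ | ⟨l, h, x, y⟩ | ⟨l, h, x, y⟩ | ⟨l, x, y⟩ <;> omega

/-- The H block is a positive wall bridge of length `m = 6k + 4`. [cite: MadrasSlade1993, §1.2, Definition 1.2.4 (p. 11)]
[cite: EntingJensen2009, §7.4.2, Fig. 7.10] -/
theorem g2h_mem_pwb {k j m : ℕ} (hk : 2 ≤ k) (hj : j ≤ 2) (hm : m = 6 * k + 4) : g2h k j ∈ pwb m :=
  mem_pwb_of_facts rfl (g2h_facts hk hj) hm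

/-- Coordinates of the H block up to its length. [cite: EntingJensen2009, §7.4.2, Fig. 7.10] -/
theorem g2h_apply {k j t : ℕ} (ht : t ≤ 6 * k + 4) : g2h k j t 0 = g2hX k j t ∧ g2h k j t 1 = g2hY k j t :=
  tab_walk_apply ht

/-- **The H block is irreducible**: its interior visits (times `t ≤ 2k−2` of the wall run) are followed by the return to column
`2 ≤ t` at time `4k − 3`. [cite: MadrasSlade1993, §4.2, Definition 4.2.1 (p. 90)] [cite: Kesten1963SAW, §4] [cite: EntingJensen2009, §7.4.2, Fig. 7.10] -/
theorem g2h_mem_ipwb {k j m : ℕ} (hk : 2 ≤ k) (hj : j ≤ 2) (hm : m = 6 * k + 4) : g2h k j ∈ ipwb m := by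
  refine mem_ipwb_of_facts_wit rfl (g2h_facts hk hj) hm (by omega) fun t ht1 ht2 hte hY => ?_
  rcases g2h_cases k j t with ⟨h, x, y⟩ | ⟨l, h, x, y⟩ | ⟨l, h, x, y⟩ | ⟨l, h, x, y⟩ | ⟨l, x, y⟩
  · refine Or.inl ⟨4 * k - 3, by omega, by omega, ?_⟩
    rcases g2h_cases k j (4 * k - 3) with ⟨h', x', y'⟩ | ⟨l', h', x', y'⟩ | ⟨l', h', x', y'⟩ | ⟨l', h', x', y'⟩ | ⟨l', x', y'⟩ <;> omega
  · omega
  · omega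
  · omega
  · omega

/-- **The H block has `k` visits**: `k − 1` on the initial wall run and the endpoint.
[cite: BeatonBousquetMelouDeGierDuminilCopinGuttmann2014, §3.1 (arXiv v5 p. 8)] [cite: EntingJensen2009, §7.4.2, Fig. 7.10] -/
theorem visits_g2h {k j m : ℕ} (hk : 2 ≤ k) (hj : j ≤ 2) (hm : m = 6 * k + 4) : visits m (g2h k j) = k := by
  have hY : ∀ t, t ≤ 6 * k + 4 → g2h k j t 1 = g2hY k j t := fun t ht => (g2h_apply ht).2
  have h1 : visits (0 + (2 * k - 1)) (g2h k j) = visits 0 (g2h k j) + ((0 + (2 * k - 1)) / 2 - 0 / 2) :=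
    visits_add_of_wall fun q _ hq => by
      rw [hY _ (by omega)]
      rcases g2h_cases k j (0 + q) with ⟨h', x', y'⟩ | ⟨l', h', x', y'⟩ | ⟨l', h', x', y'⟩ | ⟨l', h', x', y'⟩ | ⟨l', x', y'⟩ <;> omega
  have h2 : visits (2 * k - 1 + (4 * k + 3)) (g2h k j) = visits (2 * k - 1) (g2h k j) :=
    visits_add_eq_left fun q hq1 hq2 h => by
      obtain ⟨-, h0⟩ := h
      rw [hY _ (by omega)] at h0
      rcases g2h_cases k j (2 * k - 1 + q) with ⟨h', x', y'⟩ | ⟨l', h', x', y'⟩ | ⟨l', h', x', y'⟩ | ⟨l', h', x', y'⟩ | ⟨l', x', y'⟩ <;> omega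
  have h3 : visits (6 * k + 2 + 2) (g2h k j) = visits (6 * k + 2) (g2h k j) + ((6 * k + 2 + 2) / 2 - (6 * k + 2) / 2) :=
    visits_add_of_wall fun q _ hq => by
      rw [hY _ (by omega)]
      rcases g2h_cases k j (6 * k + 2 + q) with ⟨h', x', y'⟩ | ⟨l', h', x', y'⟩ | ⟨l', h', x', y'⟩ | ⟨l', h', x', y'⟩ | ⟨l', x', y'⟩ <;> omega
  rw [zero_add, visits_zero, zero_add] at h1
  rw [show 2 * k - 1 + (4 * k + 3) = 6 * k + 2 by omega, h1] at h2
  rw [h2] at h3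
  subst hm
  rw [h3]
  omega

/-- **The H block has two down steps**, at the times `2k − 1` and `4k − 3`. [cite: EntingJensen2009, §7.4.2, Fig. 7.10] -/
theorem stepsD_g2h {k j m : ℕ} (hk : 2 ≤ k) (hj : j ≤ 2) (hm : m = 6 * k + 4) :
    stepsD m (g2h k j) = {2 * k - 1, 4 * k - 3} := by
  subst hm
  ext t
  simp only [stepsD, mem_filter, mem_range, mem_insert, mem_singleton]
  constructor
  · rintro ⟨ht, hx, hy⟩
    rw [(g2h_apply (t := t + 1) (by omega)).1, (g2h_apply (t := t) (by omega)).1] at hx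
    rw [(g2h_apply (t := t + 1) (by omega)).2, (g2h_apply (t := t) (by omega)).2] at hy
    rcases g2h_cases k j t with ⟨h, x, y⟩ | ⟨l, h, x, y⟩ | ⟨l, h, x, y⟩ | ⟨l, h, x, y⟩ | ⟨l, x, y⟩ <;>
      rcases g2h_cases k j (t + 1) with ⟨h', x', y'⟩ | ⟨l', h', x', y'⟩ | ⟨l', h', x', y'⟩ | ⟨l', h', x', y'⟩ | ⟨l', x', y'⟩ <;>
        omega
  · intro ht
    have ht4 : t + 1 ≤ 6 * k + 4 := by omega
    refine ⟨by omega, ?_, ?_⟩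
    · rw [(g2h_apply ht4).1, (g2h_apply (t := t) (by omega)).1]
      rcases g2h_cases k j t with ⟨h, x, y⟩ | ⟨l, h, x, y⟩ | ⟨l, h, x, y⟩ | ⟨l, h, x, y⟩ | ⟨l, x, y⟩ <;>
        rcases g2h_cases k j (t + 1) with ⟨h', x', y'⟩ | ⟨l', h', x', y'⟩ | ⟨l', h', x', y'⟩ | ⟨l', h', x', y'⟩ | ⟨l', x', y'⟩ <;>
          omega
    · rw [(g2h_apply ht4).2, (g2h_apply (t := t) (by omega)).2]
      rcases g2h_cases k j t with ⟨h, x, y⟩ | ⟨l, h, x, y⟩ | ⟨l, h, x, y⟩ | ⟨l, h, x, y⟩ | ⟨l, x, y⟩ <;>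
        rcases g2h_cases k j (t + 1) with ⟨h', x', y'⟩ | ⟨l', h', x', y'⟩ | ⟨l', h', x', y'⟩ | ⟨l', h', x', y'⟩ | ⟨l', x', y'⟩ <;>
          omega


/-! ### §4  The `k + 3` blocks are distinct: the two-down Finset -/

/-- Two T blocks with `a < a'` differ at time `2a + 2` (row `−1` against row `0`). [cite: EntingJensen2009, §7.4.2, Fig. 7.10] -/
private theorem g2t_ne_of_lt {k a a' : ℕ} (ha : 1 ≤ a) (h : a < a') (ha'k : a' + 1 ≤ k) : g2t k a ≠ g2t k a' := by
  intro e
  have e1 := congrArg (fun w : ℕ → Site 2 => w (2 * a + 2) 1) e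
  rw [(g2t_apply (by omega)).2, (g2t_apply (by omega)).2] at e1
  rcases g2t_cases k a (2 * a + 2) with ⟨h, x, y⟩ | ⟨l, h, x, y⟩ | ⟨l, h, x, y⟩ | ⟨l, h, x, y⟩ | ⟨l, x, y⟩ <;>
    rcases g2t_cases k a' (2 * a + 2) with ⟨h', x', y'⟩ | ⟨l', h', x', y'⟩ | ⟨l', h', x', y'⟩ | ⟨l', h', x', y'⟩ | ⟨l', x', y'⟩ <;> omega

/-- Two H blocks with `j < j'` differ at time `6k − 3 + 2j` (row `−1` against row `−2`). [cite: EntingJensen2009, §7.4.2, Fig. 7.10] -/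
private theorem g2h_ne_of_lt {k j j' : ℕ} (hk : 2 ≤ k) (h : j < j') (hj' : j' ≤ 2) : g2h k j ≠ g2h k j' := by
  intro e
  have e1 := congrArg (fun w : ℕ → Site 2 => w (6 * k - 3 + 2 * j) 1) e
  rw [(g2h_apply (by omega)).2, (g2h_apply (by omega)).2] at e1
  rcases g2h_cases k j (6 * k - 3 + 2 * j) with ⟨h, x, y⟩ | ⟨l, h, x, y⟩ | ⟨l, h, x, y⟩ | ⟨l, h, x, y⟩ | ⟨l, x, y⟩ <;>
    rcases g2h_cases k j' (6 * k - 3 + 2 * j) with ⟨h', x', y'⟩ | ⟨l', h', x', y'⟩ | ⟨l', h', x', y'⟩ | ⟨l', h', x', y'⟩ | ⟨l', x', y'⟩ <;> omega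

/-- The O block ends in column `2k + 2`, a T block in column `2k + 4`. [cite: EntingJensen2009, §7.4.2, Fig. 7.10] -/
private theorem g2o_ne_g2t {k a : ℕ} : g2o k ≠ g2t k a := by
  intro e
  have e1 := congrArg (fun w : ℕ → Site 2 => w (6 * k + 4) 0) e
  rw [(g2o_apply le_rfl).1, (g2t_apply le_rfl).1] at e1
  have h1 := g2o_cases k (6 * k + 4)
  have h2 := g2t_cases k a (6 * k + 4)
  omega

/-- The O block ends in column `2k + 2`, an H block in column `2k + 6`. [cite: EntingJensen2009, §7.4.2, Fig. 7.10] -/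
private theorem g2o_ne_g2h {k j : ℕ} : g2o k ≠ g2h k j := by
  intro e
  have e1 := congrArg (fun w : ℕ → Site 2 => w (6 * k + 4) 0) e
  rw [(g2o_apply le_rfl).1, (g2h_apply le_rfl).1] at e1
  have h1 := g2o_cases k (6 * k + 4)
  have h2 := g2h_cases k j (6 * k + 4)
  omega

/-- A T block ends in column `2k + 4`, an H block in column `2k + 6`. [cite: EntingJensen2009, §7.4.2, Fig. 7.10] -/
private theorem g2t_ne_g2h {k a j : ℕ} (hak : a + 1 ≤ k) (hj : j ≤ 2) : g2t k a ≠ g2h k j := by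
  intro e
  have e1 := congrArg (fun w : ℕ → Site 2 => w (6 * k + 4) 0) e
  rw [(g2t_apply le_rfl).1, (g2h_apply le_rfl).1] at e1
  have h1 := g2t_cases k a (6 * k + 4)
  have h2 := g2h_cases k j (6 * k + 4)
  omega

open Classical in
/-- The `k − 1` T blocks (hairpin parameter `a = 1, …, k − 1`). [cite: EntingJensen2009, §7.4.2, Fig. 7.10] -/
noncomputable def g2tBlocks (k : ℕ) : Finset (ℕ → Site 2) := (range (k - 1)).image fun a => g2t k (a + 1)

open Classical in
/-- The three H blocks (`j = 0, 1, 2`). [cite: EntingJensen2009, §7.4.2, Fig. 7.10] -/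
noncomputable def g2hBlocks (k : ℕ) : Finset (ℕ → Site 2) := (range 3).image (g2h k)

open Classical in
/-- **The two-down Finset at slack four**: the O block, the `k − 1` T blocks and the three H blocks of length `6k + 4`.
[cite: EntingJensen2009, §7.4.2, Fig. 7.10] [cite: MadrasSlade1993, §4.2, Definition 4.2.1 (p. 90)] -/
noncomputable def twoDownBlocks (k : ℕ) : Finset (ℕ → Site 2) := insert (g2o k) (g2tBlocks k ∪ g2hBlocks k)

open Classical in
/-- `#g2tBlocks k = k − 1`. [cite: EntingJensen2009, §7.4.2, Fig. 7.10] -/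
theorem card_g2tBlocks (k : ℕ) : #(g2tBlocks k) = k - 1 := by
  rw [g2tBlocks, card_image_of_injOn, card_range]
  intro a ha a' ha' e
  simp only [coe_range, Set.mem_Iio] at ha ha'
  by_contra hne
  rcases Nat.lt_or_gt_of_ne hne with h | h
  · exact g2t_ne_of_lt (by omega) (by omega) (by omega) e
  · exact g2t_ne_of_lt (by omega) (by omega) (by omega) e.symm

open Classical in
/-- `#g2hBlocks k = 3` (`k ≥ 2`). [cite: EntingJensen2009, §7.4.2, Fig. 7.10] -/
theorem card_g2hBlocks {k : ℕ} (hk : 2 ≤ k) : #(g2hBlocks k) = 3 := by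
  rw [g2hBlocks, card_image_of_injOn, card_range]
  intro j hj j' hj' e
  simp only [coe_range, Set.mem_Iio] at hj hj'
  by_contra hne
  rcases Nat.lt_or_gt_of_ne hne with h | h
  · exact g2h_ne_of_lt hk h (by omega) e
  · exact g2h_ne_of_lt hk h (by omega) e.symm

open Classical in
/-- ★★ **The two-down Finset has `k + 3` elements** (`k ≥ 2`): `5, 6, 7, 8, …`. [cite: EntingJensen2009, §7.4.2, Fig. 7.10]
[cite: MadrasSlade1993, §4.2, Definition 4.2.1 (p. 90)] -/
theorem card_twoDownBlocks {k : ℕ} (hk : 2 ≤ k) : #(twoDownBlocks k) = k + 3 := by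
  have hd : Disjoint (g2tBlocks k) (g2hBlocks k) := by
    refine disjoint_left.2 fun ω h1 h2 => ?_
    simp only [g2tBlocks, g2hBlocks, mem_image, mem_range] at h1 h2
    obtain ⟨a, ha, rfl⟩ := h1
    obtain ⟨j, hj, e⟩ := h2
    exact g2t_ne_g2h (by omega) (by omega) e.symm
  have ho : g2o k ∉ g2tBlocks k ∪ g2hBlocks k := by
    intro h
    simp only [mem_union, g2tBlocks, g2hBlocks, mem_image, mem_range] at h
    rcases h with ⟨a, ha, e⟩ | ⟨j, hj, e⟩
    · exact g2o_ne_g2t e.symm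
    · exact g2o_ne_g2h e.symm
  rw [twoDownBlocks, card_insert_of_notMem ho, card_union_of_disjoint hd, card_g2tBlocks, card_g2hBlocks hk]
  omega

open Classical in
/-- ★★ **Every element of the two-down Finset is an irreducible positive wall bridge of length `6k + 4` with exactly `k`
visits and exactly two down steps** (`k ≥ 2`, length symbolic). [cite: MadrasSlade1993, §4.2, Definition 4.2.1 (p. 90)]
[cite: Kesten1963SAW, §4] [cite: BeatonBousquetMelouDeGierDuminilCopinGuttmann2014, §3.1 (arXiv v5 p. 8)] -/
theorem twoDownBlocks_subset {k m : ℕ} (hk : 2 ≤ k) (hm : m = 6 * k + 4) :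
    twoDownBlocks k ⊆ (ipwb m).filter fun ω => visits m ω = k ∧ #(stepsD m ω) = 2 := by
  intro ω hω
  rw [mem_filter]
  simp only [twoDownBlocks, g2tBlocks, g2hBlocks, mem_insert, mem_union, mem_image, mem_range] at hω
  rcases hω with rfl | ⟨a, ha, rfl⟩ | ⟨j, hj, rfl⟩
  · exact ⟨g2o_mem_ipwb (by omega) hm, visits_g2o (by omega) hm, by rw [stepsD_g2o (by omega) hm]; exact card_pair (by omega)⟩
  · exact ⟨g2t_mem_ipwb (by omega) (by omega) hm, visits_g2t (by omega) (by omega) hm,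
      by rw [stepsD_g2t (by omega) (by omega) hm]; exact card_pair (by omega)⟩
  · exact ⟨g2h_mem_ipwb hk (by omega) hm, visits_g2h hk (by omega) hm,
      by rw [stepsD_g2h hk (by omega) hm]; exact card_pair (by omega)⟩

/-- ★★ **Lower bound**: for every `k ≥ 2` there are at least `k + 3` irreducible positive wall bridges of length `6k + 4` with
`k` visits and two down steps. [cite: MadrasSlade1993, §4.2, Definition 4.2.1 (p. 90), (4.2.2)] [cite: EntingJensen2009, §7.4.2, Fig. 7.10] -/
theorem add_three_le_card_filter_visits_two_down {k m : ℕ} (hk : 2 ≤ k) (hm : m = 6 * k + 4) :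
    k + 3 ≤ #((ipwb m).filter fun ω => visits m ω = k ∧ #(stepsD m ω) = 2) := by
  classical
  rw [← card_twoDownBlocks hk]
  exact card_le_card (twoDownBlocks_subset hk hm)


/-! ### §5  Classification of the profile `D D U U` at slack four: the runs, the signs, the tables -/

/-- DDUU at slack four, step 1 — **the runs** (cf. `dduu_runs` at slack two): run 1 on row `−1` (direction `e1`) to the second down
step at the even column `b = ω q 0`, run 2 on row `−2` (direction `e2`) to the first up step at the even column `c = ω r 0`, run 3 on
row `−1` (direction `e3`) to the last up step at `d = ω s 0`, run 4 rightward on the wall; the visit count `v = ⌊p/2⌋ + (m−s)/2 = k`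
gives `s = p + 4k + 3`, and the gap and charge counts `2k + 2 ≤ X ≤ 2k + 6` of `HexSAWSurfaceWallRenewalSixStepRigid` give
`d ∈ {p+2, p+4, p+6}`. [cite: MadrasSlade1993, §4.2, Definition 4.2.1 (p. 90); EntingJensen2009, §7.4.2, Fig. 7.10] -/
theorem dduu4_runs {k m : ℕ} (hk : 2 ≤ k) (hm : m = 6 * k + 4) (hω : ω ∈ ipwb m) (hv : visits m ω = k)
    {p q r s : ℕ} (hDpq : stepsD m ω = {p, q}) (hUrs : stepsU m ω = {r, s}) (hpq : p < q) (hrs : r < s)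
    (hqr : q < r) (hp1 : 1 ≤ p) (hR0 : ∀ i, i ≤ p → ω i 0 = i ∧ ω i 1 = 0)
    (hP1x : ω (p + 1) 0 = p) (hP1y : ω (p + 1) 1 = -1)
    (hhor : ∀ i, i < m → i ≠ p → i ≠ q → i ≠ r → i ≠ s →
      ω (i + 1) 1 = ω i 1 ∧ (ω (i + 1) 0 = ω i 0 + 1 ∨ ω (i + 1) 0 = ω i 0 - 1)) :
    ∃ e1 e2 e3 : ℤ, (e1 = 1 ∨ e1 = -1) ∧ (e2 = 1 ∨ e2 = -1) ∧ (e3 = 1 ∨ e3 = -1) ∧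
      (∀ i, p + 1 ≤ i → i ≤ q → ω i 0 = p + e1 * ((i - (p + 1) : ℕ) : ℤ) ∧ ω i 1 = -1) ∧
      (∀ i, q + 1 ≤ i → i ≤ r → ω i 0 = ω q 0 + e2 * ((i - (q + 1) : ℕ) : ℤ) ∧ ω i 1 = -2) ∧
      (∀ i, r + 1 ≤ i → i ≤ s → ω i 0 = ω r 0 + e3 * ((i - (r + 1) : ℕ) : ℤ) ∧ ω i 1 = -1) ∧
      (∀ j, s + 1 ≤ j → j ≤ m → ω j 0 = ω s 0 + ((j - (s + 1) : ℕ) : ℤ) ∧ ω j 1 = 0) ∧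
      s = p + 4 * k + 3 ∧ (ω s 0 = p + 2 ∨ ω s 0 = p + 4 ∨ ω s 0 = p + 6) ∧ ω q 0 % 2 = 0 ∧ ω r 0 % 2 = 0 ∧ 0 < ω q 0 ∧
      0 < ω r 0 ∧ p + 2 ≤ q ∧ q + 2 ≤ r ∧ s < m ∧ ω r 0 ≤ ω m 0 := by
  classical
  obtain ⟨hpw, hn1, hirr⟩ := mem_ipwb.1 hω
  obtain ⟨hw, hb⟩ := mem_pwb.1 hpw
  obtain ⟨ha, -⟩ := mem_wbr.1 hw
  obtain ⟨hh, -, -⟩ := mem_archs.1 ha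
  obtain ⟨hs, hhp⟩ := mem_hpw.1 hh
  obtain ⟨h0, -, hbw, hinj⟩ := mem_saws_iff.1 hs
  have hX0 : ω 0 0 = 0 := by rw [h0]; rfl
  have hb' : ∀ i, 1 ≤ i → i ≤ m → 0 < ω i 0 ∧ ω i 0 ≤ ω m 0 := fun i h1 h2 => by
    have := hb i h1 h2; rwa [hX0] at this
  have hmem : ∀ i, i ≤ m → i ∈ {i | i ≤ m} := fun i hi => hi
  obtain ⟨hpn, hpx, hpy, hppar⟩ := of_mem_stepsD_coord hbw (i := p) (by rw [hDpq]; simp)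
  obtain ⟨hqn, hqx, hqy, hqpar⟩ := of_mem_stepsD_coord hbw (i := q) (by rw [hDpq]; simp)
  obtain ⟨hrn, hrx, hry, hrpar⟩ := of_mem_stepsU_coord hbw (i := r) (by rw [hUrs]; simp)
  obtain ⟨hsn, hsx, hsy, hspar⟩ := of_mem_stepsU_coord hbw (i := s) (by rw [hUrs]; simp)
  -- run 1 on row `−1`
  obtain ⟨e1, he1, hrun1⟩ := run_const_velocity hinj (a := p + 1) (b := q) (by omega) (by omega)
    (fun i h1 h2 => hhor i (by omega) (by omega) (by omega) (by omega) (by omega))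
  have hQy : ω q 1 = -1 := by rw [(hrun1 q (by omega) le_rfl).2, hP1y]
  have hQ1y : ω (q + 1) 1 = -2 := by rw [hqy, hQy]; rfl
  have hbev : ω q 0 % 2 = 0 := by rw [hqx, hQ1y] at hqpar; omega
  have hb1 := (hb' q (by omega) (by omega)).1
  -- run 2 on row `−2`
  obtain ⟨e2, he2, hrun2⟩ := run_const_velocity hinj (a := q + 1) (b := r) (by omega) (by omega)
    (fun i h1 h2 => hhor i (by omega) (by omega) (by omega) (by omega) (by omega))
  have hRy : ω r 1 = -2 := by rw [(hrun2 r (by omega) le_rfl).2, hQ1y]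
  have hR1y : ω (r + 1) 1 = -1 := by rw [hry, hRy]; rfl
  have hcev : ω r 0 % 2 = 0 := by rw [hRy] at hrpar; omega
  have hc1 := (hb' r (by omega) (by omega)).1
  have hcX := (hb' r (by omega) (by omega)).2
  -- run 3 on row `−1`
  obtain ⟨e3, he3, hrun3⟩ := run_const_velocity hinj (a := r + 1) (b := s) (by omega) (by omega)
    (fun i h1 h2 => hhor i (by omega) (by omega) (by omega) (by omega) (by omega))
  have hSy : ω s 1 = -1 := by rw [(hrun3 s (by omega) le_rfl).2, hR1y]
  have hS1y : ω (s + 1) 1 = 0 := by rw [hsy, hSy]; rfl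
  have hsev : s % 2 = 0 := by have := parity_apply hs (show s ≤ m by omega); rw [hSy] at this; omega
  have hdodd : ω s 0 % 2 = 1 := by rw [hSy] at hspar; omega
  -- run 4 on the wall goes right
  obtain ⟨e4, he4, hrun4⟩ := run_const_velocity hinj (a := s + 1) (b := m) (by omega) le_rfl
    (fun i h1 h2 => hhor i (by omega) (by omega) (by omega) (by omega) (by omega))
  obtain rfl : e4 = 1 := by
    rcases he4 with h | rfl
    · exact h
    exfalso
    have hN := (hrun4 m (by omega) le_rfl).1
    have hbn := (hb' (s + 1) (by omega) (by omega)).2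
    rw [hsx] at hN hbn
    omega
  have hR4 : ∀ j, s + 1 ≤ j → j ≤ m → ω j 0 = ω s 0 + ((j - (s + 1) : ℕ) : ℤ) ∧ ω j 1 = 0 := fun j h1 h2 => by
    obtain ⟨hx, hy⟩ := hrun4 j h1 h2
    rw [hsx] at hx; rw [hS1y] at hy
    exact ⟨by rw [hx]; ring, hy⟩
  -- the visit count `v = ⌊p/2⌋ + (m − s)/2`
  have hvf : visits m ω = p / 2 + (m - s) / 2 := by
    have hv1 : visits p ω = p / 2 := visits_eq_div_two_of_wall (fun i _ h2 => (hR0 i h2).2)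
    have hv2 : visits s ω = visits p ω := by
      have := visits_add_eq_left (k := p) (b := s - p) (ζ := ω) (fun j hj1 hj2 => ?_)
      · rwa [show p + (s - p) = s by omega] at this
      rintro ⟨-, hy⟩
      rcases Nat.lt_or_ge (p + j) (q + 1) with hj | hj
      · have := (hrun1 (p + j) (by omega) (by omega)).2; rw [hP1y] at this; omega
      rcases Nat.lt_or_ge (p + j) (r + 1) with hj' | hj'
      · have := (hrun2 (p + j) hj (by omega)).2; rw [hQ1y] at this; omega
      · have := (hrun3 (p + j) hj' (by omega)).2; rw [hR1y] at this; omega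
    have hv3 : visits m ω = visits s ω + visits (m - s) (fun _ => (0 : Site 2)) := by
      have := visits_add (a := s) (b := m - s) (ζ := ω) (ξ := fun _ => (0 : Site 2)) hsev (fun j hj1 hj2 => ?_)
      · rwa [show s + (m - s) = m by omega] at this
      rw [(hR4 (s + j) (by omega) (by omega)).2]; rfl
    have hv4 : visits (m - s) (fun _ => (0 : Site 2)) = (m - s) / 2 := visits_eq_div_two_of_wall (fun i _ _ => rfl)
    rw [hv3, hv2, hv1, hv4]
  -- slack-four numerics: `2k + 2 ≤ X ≤ 2k + 6` (gap count and charge count)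
  have hX1 := two_mul_visits_add_two_le_apply hω (by omega)
  have hX2 := apply_add_four_mul_visits_le hω (by omega)
  rw [hv] at hX1 hX2
  have hN := (hR4 m (by omega) le_rfl).1
  rw [hvf] at hv
  have hpodd : p % 2 = 1 := by rw [hP1x, hP1y] at hppar; omega
  have hs_eq : s = p + 4 * k + 3 := by omega
  have hd3 : ω s 0 = p + 2 ∨ ω s 0 = p + 4 ∨ ω s 0 = p + 6 := by
    subst hs_eq; rw [hm] at hN hX1 hX2; push_cast at hN hX1 hX2; omega
  have hq2 : p + 2 ≤ q := by
    by_contra h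
    obtain rfl : q = p + 1 := by omega
    rw [hqx, hP1x] at hqpar; rw [hQ1y] at hqpar; omega
  have hr2 : q + 2 ≤ r := by
    by_contra h
    obtain rfl : r = q + 1 := by omega
    have := hinj (hmem (q + 1 + 1) (by omega)) (hmem q (by omega)) (site_ext_td (by rw [hrx, hqx]) (by rw [hR1y, hQy]))
    omega
  refine ⟨e1, e2, e3, he1, he2, he3, fun i h1 h2 => ⟨by rw [(hrun1 i h1 h2).1, hP1x], by rw [(hrun1 i h1 h2).2, hP1y]⟩,
    fun i h1 h2 => ⟨by rw [(hrun2 i h1 h2).1, hqx], by rw [(hrun2 i h1 h2).2, hQ1y]⟩,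
    fun i h1 h2 => ⟨by rw [(hrun3 i h1 h2).1, hrx], by rw [(hrun3 i h1 h2).2, hR1y]⟩, hR4, hs_eq, hd3, hbev, hcev, hb1,
    hc1, hq2, hr2, hsn, hcX⟩

/-- DDUU at slack four, step 2 — **the signs and columns**: either the dive is at column `1` and run 1 steps RIGHT once
(then run 2 reaches `X = 2k + 2` and run 3 returns leftward to column `3`: the O block), or run 1 is the hairpin return to
column `2`, run 2 goes right beyond column `p`, and then either run 3 returns LEFTWARD (the lengths force `c = 2k + 4`,
`d = p + 4`: the T blocks) or run 3 continues RIGHTWARD (the lengths force `p = 2k − 1`, `d = 2k + 5`, and `c` is an even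
column strictly between: the H blocks).  Excluded: a rightward run 1 from `p ≥ 3` by (I1) (run 3 would climb through column
`p`); from `p = 1` a leftward run 2 puts the start of run 3 on run 1, and two rightward runs below contradict (I2).
[cite: MadrasSlade1993, §4.2, Definition 4.2.1 (p. 90); EntingJensen2009, §7.4.2, Fig. 7.10] -/
theorem dduu4_signs {k m p q r s : ℕ} {e1 e2 e3 : ℤ} (hk : 2 ≤ k) (hm : m = 6 * k + 4) (he1 : e1 = 1 ∨ e1 = -1)
    (he2 : e2 = 1 ∨ e2 = -1) (he3 : e3 = 1 ∨ e3 = -1) (hp1 : 1 ≤ p) (hpodd : p % 2 = 1) (hrs : r < s)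
    (hs_eq : s = p + 4 * k + 3) (hd3 : ω s 0 = p + 2 ∨ ω s 0 = p + 4 ∨ ω s 0 = p + 6) (hbev : ω q 0 % 2 = 0)
    (hcev : ω r 0 % 2 = 0) (hb1 : 0 < ω q 0) (hc1 : 0 < ω r 0) (hq2 : p + 2 ≤ q) (hr2 : q + 2 ≤ r) (hsm : s < m)
    (hcX : ω r 0 ≤ ω m 0)
    (hbq : ω q 0 = p + e1 * ((q - (p + 1) : ℕ) : ℤ)) (hcr : ω r 0 = ω q 0 + e2 * ((r - (q + 1) : ℕ) : ℤ))
    (hds : ω s 0 = ω r 0 + e3 * ((s - (r + 1) : ℕ) : ℤ)) (hN : ω m 0 = ω s 0 + ((m - (s + 1) : ℕ) : ℤ))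
    (hP1x : ω (p + 1) 0 = p) (hrx : ω (r + 1) 0 = ω r 0)
    (hrun1 : ∀ i, p + 1 ≤ i → i ≤ q → ω i 0 = p + e1 * ((i - (p + 1) : ℕ) : ℤ))
    (hrun3 : ∀ i, r + 1 ≤ i → i ≤ s → ω i 0 = ω r 0 + e3 * ((i - (r + 1) : ℕ) : ℤ))
    (hdisj : ∀ i j, p + 1 ≤ i → i ≤ q → r + 1 ≤ j → j ≤ s → ω i 0 ≠ ω j 0)
    (hI1 : 3 ≤ p → ω q 0 ≤ 2 ∨ ω r 0 ≤ 2) (hI2 : s + 4 ≤ m → ω m 0 ≤ ω q 0 + 1 ∨ ω m 0 ≤ ω r 0 + 1) :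
    (p = 1 ∧ e1 = 1 ∧ ω q 0 = 2 ∧ e2 = 1 ∧ ω r 0 = 2 * k + 2 ∧ e3 = -1 ∧ ω s 0 = 3) ∨
      (e1 = -1 ∧ ω q 0 = 2 ∧ e2 = 1 ∧ e3 = -1 ∧ ω r 0 = 2 * k + 4 ∧ ω s 0 = p + 4 ∧ p + 2 ≤ 2 * k + 1) ∨
      (e1 = -1 ∧ ω q 0 = 2 ∧ e2 = 1 ∧ e3 = 1 ∧ p = 2 * k - 1 ∧ ω s 0 = 2 * k + 5 ∧
        (ω r 0 = 2 * k ∨ ω r 0 = 2 * k + 2 ∨ ω r 0 = 2 * k + 4)) := by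
  rcases he1 with rfl | rfl
  · -- run 1 rightward: only the dive at column `1` survives
    left
    rcases Nat.lt_or_ge p 3 with hp3 | hp3
    · obtain rfl : p = 1 := by omega
      have hbd : ω q 0 < ω s 0 := by
        -- else the last up column `d ≤ b` lies on run 1
        by_contra hge
        refine hdisj ((ω s 0).toNat + 1) s (by omega) (by omega) (by omega) le_rfl ?_
        rw [hrun1 ((ω s 0).toNat + 1) (by omega) (by omega)]; omega
      rcases he2 with rfl | rfl
      · rcases he3 with rfl | rfl
        · -- three rightward runs: `X = d + 2k − 1` exceeds `b + 1` and `c + 1`, against (I2)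
          exfalso
          rcases hI2 (by omega) with h | h <;> omega
        · -- run 3 leftward: `c ≥ X − 1` by (I2), the lengths give `d = 3`, `c = X = 2k + 2`, and `b < d` gives `b = 2`
          rcases hI2 (by omega) with h | h
          · exfalso; omega
          · refine ⟨rfl, rfl, ?_, rfl, ?_, rfl, ?_⟩ <;> omega
      · -- run 2 leftward from `b`: the first up column `c ∈ [1, b − 1]` lies on run 1
        exfalso
        refine hdisj ((ω r 0).toNat + 1) (r + 1) (by omega) (by omega) le_rfl (by omega) ?_
        rw [hrun1 ((ω r 0).toNat + 1) (by omega) (by omega), hrx]; omega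
    · -- `p ≥ 3`: (I1) gives `c ≤ 2` (`b > p`), and run 3 must then climb rightward through column `p = ω (p+1) 0`
      exfalso
      rcases hI1 hp3 with hb2 | hc2
      · omega
      · rcases he3 with rfl | rfl
        · refine hdisj (p + 1) (r + 1 + (p - (ω r 0).toNat)) le_rfl (by omega) (by omega) (by omega) ?_
          rw [hP1x, hrun3 (r + 1 + (p - (ω r 0).toNat)) (by omega) (by omega)]; omega
        · omega
  · -- run 1 leftward: the hairpin return to column `2`, then run 2 rightward beyond column `p`
    right
    have hp3 : 3 ≤ p := by omega
    have hb2 : ω q 0 = 2 := by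
      rcases hI1 hp3 with hb2 | hc2
      · omega
      · exfalso
        rcases he3 with rfl | rfl
        · refine hdisj q (r + 1 + ((ω q 0).toNat - 2)) (by omega) le_rfl (by omega) (by omega) ?_
          rw [hrun3 (r + 1 + ((ω q 0).toNat - 2)) (by omega) (by omega)]; omega
        · omega
    have hE2 : e2 = 1 := by
      rcases he2 with h | rfl
      · exact h
      exfalso; omega
    subst hE2
    have hcp : (p : ℤ) < ω r 0 := by
      by_contra hle
      refine hdisj (p + 1 + (p - (ω r 0).toNat)) (r + 1) (by omega) (by omega) le_rfl (by omega) ?_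
      rw [hrun1 (p + 1 + (p - (ω r 0).toNat)) (by omega) (by omega), hrx]; omega
    rcases he3 with rfl | rfl
    · -- run 3 rightward: `d = 4k + 4 − p ∈ {p+2, p+4, p+6}` with `p` odd and `s < m` forces `p = 2k − 1`
      right
      refine ⟨rfl, hb2, rfl, rfl, ?_, ?_, ?_⟩ <;> omega
    · -- run 3 leftward: `2c = 4k + 4 + (d − p)` with `c` even forces `c = 2k + 4`, `d = p + 4`
      left
      refine ⟨rfl, hb2, rfl, rfl, ?_, ?_, ?_⟩ <;> omega

/-- DDUU at slack four, step 3a — **the O table**: with the O signs and columns (`p = 1`, `b = 2`, `c = 2k + 2`, `d = 3`) the walk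
agrees with the O table at every time `≤ m`. [cite: MadrasSlade1993, §4.2, Definition 4.2.1 (p. 90); EntingJensen2009, §7.4.2, Fig. 7.10] -/
theorem dduu4_table_o {k m p q r s : ℕ} {e1 e2 e3 : ℤ}
    (hR0 : ∀ i, i ≤ p → ω i 0 = i ∧ ω i 1 = 0)
    (hrun1 : ∀ i, p + 1 ≤ i → i ≤ q → ω i 0 = p + e1 * ((i - (p + 1) : ℕ) : ℤ) ∧ ω i 1 = -1)
    (hrun2 : ∀ i, q + 1 ≤ i → i ≤ r → ω i 0 = ω q 0 + e2 * ((i - (q + 1) : ℕ) : ℤ) ∧ ω i 1 = -2)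
    (hrun3 : ∀ i, r + 1 ≤ i → i ≤ s → ω i 0 = ω r 0 + e3 * ((i - (r + 1) : ℕ) : ℤ) ∧ ω i 1 = -1)
    (hR4 : ∀ j, s + 1 ≤ j → j ≤ m → ω j 0 = ω s 0 + ((j - (s + 1) : ℕ) : ℤ) ∧ ω j 1 = 0)
    (hpq : p < q) (hqr : q < r) (hrs : r < s) (hpodd : p % 2 = 1) (hs_eq : s = p + 4 * k + 3)
    (hbq : ω q 0 = p + e1 * ((q - (p + 1) : ℕ) : ℤ)) (hcr : ω r 0 = ω q 0 + e2 * ((r - (q + 1) : ℕ) : ℤ))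
    (hds : ω s 0 = ω r 0 + e3 * ((s - (r + 1) : ℕ) : ℤ))
    (hp : p = 1) (he1 : e1 = 1) (hb : ω q 0 = 2) (he2 : e2 = 1) (hc : ω r 0 = 2 * k + 2) (he3 : e3 = -1) (hd : ω s 0 = 3) :
    ∀ i, i ≤ m → ω i 0 = g2oX k i ∧ ω i 1 = g2oY k i := by
  subst hp he1 he2 he3
  have hq_eq : q = 3 := by omega
  have hr_eq : r = 2 * k + 4 := by omega
  clear hcr hds hbq
  intro i hi
  simp only [g2oX, g2oY]
  rcases Nat.lt_or_ge i (1 + 1) with h1 | h1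
  · obtain ⟨hx, hy⟩ := hR0 i (by omega)
    rw [hx, hy]; constructor <;> split_ifs <;> omega
  rcases Nat.lt_or_ge i (q + 1) with h2 | h2
  · obtain ⟨hx, hy⟩ := hrun1 i h1 (by omega)
    rw [hx, hy]; constructor <;> split_ifs <;> omega
  rcases Nat.lt_or_ge i (r + 1) with h3 | h3
  · obtain ⟨hx, hy⟩ := hrun2 i h2 (by omega)
    rw [hx, hy]; constructor <;> split_ifs <;> omega
  rcases Nat.lt_or_ge i (s + 1) with h4 | h4
  · obtain ⟨hx, hy⟩ := hrun3 i h3 (by omega)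
    rw [hx, hy]; constructor <;> split_ifs <;> omega
  · obtain ⟨hx, hy⟩ := hR4 i h4 hi
    rw [hx, hy]; constructor <;> split_ifs <;> omega

/-- DDUU at slack four, step 3b — **the T tables**: with the T signs and columns (hairpin to `b = 2`, `c = 2k + 4`, leftward return to
`d = p + 4`) the walk agrees with the T table of parameter `a = (p−1)/2` at every time `≤ m`.
[cite: MadrasSlade1993, §4.2, Definition 4.2.1 (p. 90); EntingJensen2009, §7.4.2, Fig. 7.10] -/
theorem dduu4_table_t {k m p q r s : ℕ} {e1 e2 e3 : ℤ} (hm : m = 6 * k + 4)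
    (hR0 : ∀ i, i ≤ p → ω i 0 = i ∧ ω i 1 = 0)
    (hrun1 : ∀ i, p + 1 ≤ i → i ≤ q → ω i 0 = p + e1 * ((i - (p + 1) : ℕ) : ℤ) ∧ ω i 1 = -1)
    (hrun2 : ∀ i, q + 1 ≤ i → i ≤ r → ω i 0 = ω q 0 + e2 * ((i - (q + 1) : ℕ) : ℤ) ∧ ω i 1 = -2)
    (hrun3 : ∀ i, r + 1 ≤ i → i ≤ s → ω i 0 = ω r 0 + e3 * ((i - (r + 1) : ℕ) : ℤ) ∧ ω i 1 = -1)
    (hR4 : ∀ j, s + 1 ≤ j → j ≤ m → ω j 0 = ω s 0 + ((j - (s + 1) : ℕ) : ℤ) ∧ ω j 1 = 0)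
    (hpq : p < q) (hqr : q < r) (hrs : r < s) (hsm : s < m) (hpodd : p % 2 = 1) (hs_eq : s = p + 4 * k + 3)
    (hbq : ω q 0 = p + e1 * ((q - (p + 1) : ℕ) : ℤ)) (hcr : ω r 0 = ω q 0 + e2 * ((r - (q + 1) : ℕ) : ℤ))
    (hds : ω s 0 = ω r 0 + e3 * ((s - (r + 1) : ℕ) : ℤ))
    (he1 : e1 = -1) (hb : ω q 0 = 2) (he2 : e2 = 1) (he3 : e3 = -1) (hc : ω r 0 = 2 * k + 4) (hd : ω s 0 = p + 4) :
    ∃ a, 1 ≤ a ∧ a + 1 ≤ k ∧ ∀ i, i ≤ m → ω i 0 = g2tX k a i ∧ ω i 1 = g2tY k a i := by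
  subst he1 he2 he3
  have hq_eq : q = 2 * p - 1 := by omega
  have hr_eq : r = 2 * p + 2 * k + 2 := by omega
  clear hcr hds hbq
  refine ⟨p / 2, by omega, by omega, fun i hi => ?_⟩
  simp only [g2tX, g2tY]
  rcases Nat.lt_or_ge i (p + 1) with h1 | h1
  · obtain ⟨hx, hy⟩ := hR0 i (by omega)
    rw [hx, hy]; constructor <;> split_ifs <;> omega
  rcases Nat.lt_or_ge i (q + 1) with h2 | h2
  · obtain ⟨hx, hy⟩ := hrun1 i h1 (by omega)
    rw [hx, hy]; constructor <;> split_ifs <;> omega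
  rcases Nat.lt_or_ge i (r + 1) with h3 | h3
  · obtain ⟨hx, hy⟩ := hrun2 i h2 (by omega)
    rw [hx, hy]; constructor <;> split_ifs <;> omega
  rcases Nat.lt_or_ge i (s + 1) with h4 | h4
  · obtain ⟨hx, hy⟩ := hrun3 i h3 (by omega)
    rw [hx, hy]; constructor <;> split_ifs <;> omega
  · obtain ⟨hx, hy⟩ := hR4 i h4 hi
    rw [hx, hy]; constructor <;> split_ifs <;> omega

/-- DDUU at slack four, step 3c — **the H tables**: with the H signs and columns (`p = 2k − 1`, hairpin to `b = 2`, `c ∈ {2k, 2k+2,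
2k+4}`, rightward to `d = 2k + 5`) the walk agrees with the H table of parameter `j = (c − 2k)/2` at every time `≤ m`.
[cite: MadrasSlade1993, §4.2, Definition 4.2.1 (p. 90); EntingJensen2009, §7.4.2, Fig. 7.10] -/
theorem dduu4_table_h {k m p q r s : ℕ} {e1 e2 e3 : ℤ} (hk : 2 ≤ k) (hm : m = 6 * k + 4)
    (hR0 : ∀ i, i ≤ p → ω i 0 = i ∧ ω i 1 = 0)
    (hrun1 : ∀ i, p + 1 ≤ i → i ≤ q → ω i 0 = p + e1 * ((i - (p + 1) : ℕ) : ℤ) ∧ ω i 1 = -1)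
    (hrun2 : ∀ i, q + 1 ≤ i → i ≤ r → ω i 0 = ω q 0 + e2 * ((i - (q + 1) : ℕ) : ℤ) ∧ ω i 1 = -2)
    (hrun3 : ∀ i, r + 1 ≤ i → i ≤ s → ω i 0 = ω r 0 + e3 * ((i - (r + 1) : ℕ) : ℤ) ∧ ω i 1 = -1)
    (hR4 : ∀ j, s + 1 ≤ j → j ≤ m → ω j 0 = ω s 0 + ((j - (s + 1) : ℕ) : ℤ) ∧ ω j 1 = 0)
    (hpq : p < q) (hqr : q < r) (hrs : r < s) (hsm : s < m) (hpodd : p % 2 = 1) (hs_eq : s = p + 4 * k + 3)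
    (hbq : ω q 0 = p + e1 * ((q - (p + 1) : ℕ) : ℤ)) (hcr : ω r 0 = ω q 0 + e2 * ((r - (q + 1) : ℕ) : ℤ))
    (hds : ω s 0 = ω r 0 + e3 * ((s - (r + 1) : ℕ) : ℤ))
    (he1 : e1 = -1) (hb : ω q 0 = 2) (he2 : e2 = 1) (he3 : e3 = 1) (hp : p = 2 * k - 1) (hd : ω s 0 = 2 * k + 5)
    (hc : ω r 0 = 2 * k ∨ ω r 0 = 2 * k + 2 ∨ ω r 0 = 2 * k + 4) :
    ∃ j, j ≤ 2 ∧ ∀ i, i ≤ m → ω i 0 = g2hX k j i ∧ ω i 1 = g2hY k j i := by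
  subst he1 he2 he3 hp
  obtain ⟨j, hj, hcj⟩ : ∃ j : ℕ, j ≤ 2 ∧ ω r 0 = 2 * k + 2 * j := by
    rcases hc with h | h | h
    · exact ⟨0, by omega, by rw [h]; ring⟩
    · exact ⟨1, by omega, by rw [h]; ring⟩
    · exact ⟨2, le_rfl, by rw [h]; ring⟩
  have hq_eq : q = 4 * k - 3 := by omega
  have hr_eq : r = 6 * k - 4 + 2 * j := by omega
  clear hcr hds hbq hc
  refine ⟨j, hj, fun i hi => ?_⟩
  simp only [g2hX, g2hY]
  rcases Nat.lt_or_ge i (2 * k - 1 + 1) with h1 | h1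
  · obtain ⟨hx, hy⟩ := hR0 i (by omega)
    rw [hx, hy]; constructor <;> split_ifs <;> omega
  rcases Nat.lt_or_ge i (q + 1) with h2 | h2
  · obtain ⟨hx, hy⟩ := hrun1 i h1 (by omega)
    rw [hx, hy]; constructor <;> split_ifs <;> omega
  rcases Nat.lt_or_ge i (r + 1) with h3 | h3
  · obtain ⟨hx, hy⟩ := hrun2 i h2 (by omega)
    rw [hx, hy]; constructor <;> split_ifs <;> omega
  rcases Nat.lt_or_ge i (s + 1) with h4 | h4
  · obtain ⟨hx, hy⟩ := hrun3 i h3 (by omega)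
    rw [hx, hy]; constructor <;> split_ifs <;> omega
  · obtain ⟨hx, hy⟩ := hR4 i h4 hi
    rw [hx, hy]; constructor <;> split_ifs <;> omega

/-- DDUU at slack four, step 3 — **the tables**: with the signs and columns fixed, the walk agrees with the O table, a T table
(`a = (p−1)/2`) or an H table (`j = (c − 2k)/2`) at every time `≤ m`.
[cite: MadrasSlade1993, §4.2, Definition 4.2.1 (p. 90); EntingJensen2009, §7.4.2, Fig. 7.10] -/
theorem dduu4_tables {k m p q r s : ℕ} {e1 e2 e3 : ℤ} (hk : 2 ≤ k) (hm : m = 6 * k + 4)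
    (hR0 : ∀ i, i ≤ p → ω i 0 = i ∧ ω i 1 = 0)
    (hrun1 : ∀ i, p + 1 ≤ i → i ≤ q → ω i 0 = p + e1 * ((i - (p + 1) : ℕ) : ℤ) ∧ ω i 1 = -1)
    (hrun2 : ∀ i, q + 1 ≤ i → i ≤ r → ω i 0 = ω q 0 + e2 * ((i - (q + 1) : ℕ) : ℤ) ∧ ω i 1 = -2)
    (hrun3 : ∀ i, r + 1 ≤ i → i ≤ s → ω i 0 = ω r 0 + e3 * ((i - (r + 1) : ℕ) : ℤ) ∧ ω i 1 = -1)
    (hR4 : ∀ j, s + 1 ≤ j → j ≤ m → ω j 0 = ω s 0 + ((j - (s + 1) : ℕ) : ℤ) ∧ ω j 1 = 0)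
    (hpq : p < q) (hqr : q < r) (hrs : r < s) (hsm : s < m) (hpodd : p % 2 = 1) (hs_eq : s = p + 4 * k + 3)
    (hbq : ω q 0 = p + e1 * ((q - (p + 1) : ℕ) : ℤ)) (hcr : ω r 0 = ω q 0 + e2 * ((r - (q + 1) : ℕ) : ℤ))
    (hds : ω s 0 = ω r 0 + e3 * ((s - (r + 1) : ℕ) : ℤ))
    (hsig : (p = 1 ∧ e1 = 1 ∧ ω q 0 = 2 ∧ e2 = 1 ∧ ω r 0 = 2 * k + 2 ∧ e3 = -1 ∧ ω s 0 = 3) ∨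
      (e1 = -1 ∧ ω q 0 = 2 ∧ e2 = 1 ∧ e3 = -1 ∧ ω r 0 = 2 * k + 4 ∧ ω s 0 = p + 4 ∧ p + 2 ≤ 2 * k + 1) ∨
      (e1 = -1 ∧ ω q 0 = 2 ∧ e2 = 1 ∧ e3 = 1 ∧ p = 2 * k - 1 ∧ ω s 0 = 2 * k + 5 ∧
        (ω r 0 = 2 * k ∨ ω r 0 = 2 * k + 2 ∨ ω r 0 = 2 * k + 4))) :
    (∀ i, i ≤ m → ω i 0 = g2oX k i ∧ ω i 1 = g2oY k i) ∨
      (∃ a, 1 ≤ a ∧ a + 1 ≤ k ∧ ∀ i, i ≤ m → ω i 0 = g2tX k a i ∧ ω i 1 = g2tY k a i) ∨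
      ∃ j, j ≤ 2 ∧ ∀ i, i ≤ m → ω i 0 = g2hX k j i ∧ ω i 1 = g2hY k j i := by
  rcases hsig with ⟨hp, he1, hb, he2, hc, he3, hd⟩ | ⟨he1, hb, he2, he3, hc, hd, -⟩ | ⟨he1, hb, he2, he3, hp, hd, hc⟩
  · exact Or.inl (dduu4_table_o hR0 hrun1 hrun2 hrun3 hR4 hpq hqr hrs hpodd hs_eq hbq hcr hds hp he1 hb he2 hc he3 hd)
  · exact Or.inr (Or.inl
      (dduu4_table_t hm hR0 hrun1 hrun2 hrun3 hR4 hpq hqr hrs hsm hpodd hs_eq hbq hcr hds he1 hb he2 he3 hc hd))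
  · exact Or.inr (Or.inr
      (dduu4_table_h hk hm hR0 hrun1 hrun2 hrun3 hR4 hpq hqr hrs hsm hpodd hs_eq hbq hcr hds he1 hb he2 he3 hp hd hc))

/-- **Profile `D D U U` at slack four is an O, T or H block** (as coordinate tables): `dduu4_runs` + `dduu_row_disjoint` +
`dduu_shield_low/high` (general length, `HexSAWSurfaceWallRenewalSlackTwoClassification`) + `dduu4_signs` + `dduu4_tables`.
[cite: MadrasSlade1993, §4.2, Definition 4.2.1 (p. 90); EntingJensen2009, §7.4.2, Fig. 7.10] -/
theorem dduu_slack_four {k m : ℕ} (hk : 2 ≤ k) (hm : m = 6 * k + 4) (hω : ω ∈ ipwb m) (hv : visits m ω = k)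
    {p q r s : ℕ} (hDpq : stepsD m ω = {p, q}) (hUrs : stepsU m ω = {r, s}) (hpq : p < q) (hrs : r < s)
    (hqr : q < r) (hp1 : 1 ≤ p) (hpodd : p % 2 = 1) (hR0 : ∀ i, i ≤ p → ω i 0 = i ∧ ω i 1 = 0)
    (hP1x : ω (p + 1) 0 = p) (hP1y : ω (p + 1) 1 = -1)
    (hhor : ∀ i, i < m → i ≠ p → i ≠ q → i ≠ r → i ≠ s →
      ω (i + 1) 1 = ω i 1 ∧ (ω (i + 1) 0 = ω i 0 + 1 ∨ ω (i + 1) 0 = ω i 0 - 1)) :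
    (∀ i, i ≤ m → ω i 0 = g2oX k i ∧ ω i 1 = g2oY k i) ∨
      (∃ a, 1 ≤ a ∧ a + 1 ≤ k ∧ ∀ i, i ≤ m → ω i 0 = g2tX k a i ∧ ω i 1 = g2tY k a i) ∨
      ∃ j, j ≤ 2 ∧ ∀ i, i ≤ m → ω i 0 = g2hX k j i ∧ ω i 1 = g2hY k j i := by
  classical
  obtain ⟨hpw, hn1, hirr⟩ := mem_ipwb.1 hω
  obtain ⟨hw, hb⟩ := mem_pwb.1 hpw
  obtain ⟨ha, -⟩ := mem_wbr.1 hw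
  obtain ⟨hh, hm2, -⟩ := mem_archs.1 ha
  obtain ⟨hs, -⟩ := mem_hpw.1 hh
  obtain ⟨-, -, -, hinj⟩ := mem_saws_iff.1 hs
  obtain ⟨e1, e2, e3, he1, he2, he3, hrun1, hrun2, hrun3, hR4, hs_eq, hd3, hbev, hcev, hb1, hc1, hq2, hr2, hsm, hcX⟩ :=
    dduu4_runs hk hm hω hv hDpq hUrs hpq hrs hqr hp1 hR0 hP1x hP1y hhor
  have hbq := (hrun1 q (by omega) le_rfl).1
  have hcr := (hrun2 r (by omega) le_rfl).1
  have hds := (hrun3 s (by omega) le_rfl).1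
  have hN := (hR4 m (by omega) le_rfl).1
  have hrx : ω (r + 1) 0 = ω r 0 := by rw [(hrun3 (r + 1) le_rfl (by omega)).1]; simp
  have hd : (p : ℤ) + 2 ≤ ω s 0 := by omega
  have hdisj := dduu_row_disjoint hinj hqr hsm hrun1 hrun3
  have hI1 : 3 ≤ p → ω q 0 ≤ 2 ∨ ω r 0 ≤ 2 := fun hp3 =>
    dduu_shield_low hb hirr hR0 he1 he2 he3 hrun1 hrun2 hrun3 hR4 hp3 hpq hqr hrs hsm hd hbq hcr hds
  have hI2 : s + 4 ≤ m → ω m 0 ≤ ω q 0 + 1 ∨ ω m 0 ≤ ω r 0 + 1 := fun hs4 =>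
    dduu_shield_high hb hirr hR0 he1 he2 he3 hrun1 hrun2 hrun3 hR4 hs4 hm2 hpq hqr hrs hd hbq hcr hds
  have hsig := dduu4_signs hk hm he1 he2 he3 hp1 hpodd hrs hs_eq hd3 hbev hcev hb1 hc1 hq2 hr2 hsm hcX hbq hcr hds hN hP1x
    hrx (fun i h1 h2 => (hrun1 i h1 h2).1) (fun i h1 h2 => (hrun3 i h1 h2).1) hdisj hI1 hI2
  exact dduu4_tables hk hm hR0 hrun1 hrun2 hrun3 hR4 hpq hqr hrs hsm hpodd hs_eq hbq hcr hds hsig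

/-! ### §6  Assembly: the two-down stratum at slack four is the two-down Finset, `k + 3` blocks -/

open Classical in
/-- ★★★ **Two down steps at slack four**: an irreducible positive wall bridge of length `6k + 4` (`k ≥ 2`) with `k` visits and
exactly two down steps is the O block, a T block or an H block. [cite: MadrasSlade1993, §4.2, Definition 4.2.1 (p. 90) and the
remark before (4.2.21) (p. 94)] [cite: EntingJensen2009, §7.4.2, Fig. 7.10] -/
theorem mem_twoDownBlocks_of_card_stepsD_eq_two {k m : ℕ} (hk : 2 ≤ k) (hm : m = 6 * k + 4) (hω : ω ∈ ipwb m)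
    (hv : visits m ω = k) (hD : #(stepsD m ω) = 2) : ω ∈ twoDownBlocks k := by
  have hs : ω ∈ saws m := saws_of_mem_pwb (mem_ipwb.1 hω).1
  have hm' : 6 * k + 4 = m := hm.symm
  have hU : #(stepsU m ω) = 2 := by rw [card_stepsU_eq_card_stepsD hω (by omega), hD]
  obtain ⟨p, q, r, s, hDpq, hUrs, hpq, hrs, hpr, hqs, hp1, hpodd, hR0, hP1x, hP1y, hhor, -⟩ :=
    profile_of_card_stepsD_eq_two hω hD hU
  have hqr' : q ≠ r := by
    intro h
    obtain ⟨-, -, hbw, -⟩ := mem_saws_iff.1 hs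
    obtain ⟨-, -, hqy, -⟩ := of_mem_stepsD_coord hbw (i := q) (by rw [hDpq]; simp)
    obtain ⟨-, -, hry, -⟩ := of_mem_stepsU_coord hbw (i := r) (by rw [hUrs]; simp)
    rw [h] at hqy; omega
  rcases lt_or_gt_of_ne hqr' with hqr | hrq
  · simp only [twoDownBlocks, g2tBlocks, g2hBlocks, mem_insert, mem_union, mem_image, mem_range]
    rcases dduu_slack_four hk hm hω hv hDpq hUrs hpq hrs hqr hp1 hpodd hR0 hP1x hP1y hhor with
      htab | ⟨a, ha, hak, htab⟩ | ⟨j, hj, htab⟩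
    · exact Or.inl (by rw [g2o, hm']; exact eq_tab_walk_of_forall hs (by rw [← hm'] at htab ⊢; exact htab))
    · refine Or.inr (Or.inl ⟨a - 1, by omega, ?_⟩)
      rw [show a - 1 + 1 = a by omega, g2t, hm']
      exact (eq_tab_walk_of_forall hs (by rw [← hm'] at htab ⊢; exact htab)).symm
    · refine Or.inr (Or.inr ⟨j, by omega, ?_⟩)
      rw [g2h, hm']
      exact (eq_tab_walk_of_forall hs (by rw [← hm'] at htab ⊢; exact htab)).symm
  · exact (dudu_false_of_mem_ipwb hω hDpq hUrs hpq hrs hpr hqs hrq hR0 hP1x hP1y hhor).elim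

open Classical in
/-- ★★★ **The two-down stratum as a set**: for `k ≥ 2` and `m = 6k + 4`, the irreducible positive wall bridges of length `m` with
`k` visits and two down steps are exactly the two-down Finset. OURS. [cite: MadrasSlade1993, §4.2, Definition 4.2.1 (p. 90),
remark before (4.2.21) (p. 94)] [cite: EntingJensen2009, §7.4.2, Fig. 7.10] -/
theorem filter_visits_two_down_eq_twoDownBlocks {k m : ℕ} (hk : 2 ≤ k) (hm : m = 6 * k + 4) :
    (ipwb m).filter (fun ω => visits m ω = k ∧ #(stepsD m ω) = 2) = twoDownBlocks k := by
  refine Subset.antisymm (fun ζ hζ => ?_) (twoDownBlocks_subset hk hm)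
  rw [mem_filter] at hζ
  exact mem_twoDownBlocks_of_card_stepsD_eq_two hk hm hζ.1 hζ.2.1 hζ.2.2

open Classical in
/-- ★★★ **`#{ω ∈ ipwb (6k+4) : visits = k, #down = 2} = k + 3`** (`k ≥ 2`): `5, 6, 7, 8, 9, …` — the two-down stratum of the
slack-four census `N_{3k+2,k}`. OURS. [cite: MadrasSlade1993, §4.2, Definition 4.2.1 (p. 90), remark before (4.2.21) (p. 94)]
[cite: EntingJensen2009, §7.4.2, Fig. 7.10] -/
theorem card_filter_visits_two_down {k m : ℕ} (hk : 2 ≤ k) (hm : m = 6 * k + 4) :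
    #((ipwb m).filter fun ω => visits m ω = k ∧ #(stepsD m ω) = 2) = k + 3 := by
  classical
  rw [filter_visits_two_down_eq_twoDownBlocks hk hm, card_twoDownBlocks hk]

end Literature.Probability.RandomPlanarGeometry.SAW.HexBW.Wall
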